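import Literature.NumberTheory.EllipticCurves.WeightOneOrdinaryLiftProofs
import Literature.NumberTheory.EllipticCurves.EisensteinNewformLevelRaising
import Literature.NumberTheory.EllipticCurves.NewformGaloisRepModLOfPadicAlgClProofs
import Literature.NumberTheory.GaloisRepresentations.ResidualRepOfCongruentFrobenius
import Literature.NumberTheory.GaloisRepresentations.ArtinRepCoefficientTransport
import Literature.NumberTheory.GaloisRepresentations.ResiduallyReducibleOfStableLine
import Literature.NumberTheory.GaloisRepresentations.GoodDihedralLocalImage
import Literature.NumberTheory.GaloisRepresentations.ArtinConductorProofs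
import Literature.NumberTheory.GaloisRepresentations.ModPGaloisRepLevelProofs
import Literature.NumberTheory.GaloisRepresentations.HeckeCharacterProofs
import Literature.NumberTheory.Automorphic.DeligneSerreThm46aHolds
import HarnessLib

/-!
# A `p`-ordinary newform lift of weight `≥ 2` of the residual representation of a weight-one
# newform unramified at `p` (the classical substitute for Wiles 1988, Thm. 3, in Allen 2014,
# Lemma 87; proofs only)

Topic `Literature/NumberTheory/Automorphic`; namespace `Literature.NumberTheory.Automorphic`.
THEOREMS ONLY (no definition, no named fact; D-0026).  A proofs-only companion of the named fact
`Literature.NumberTheory.Automorphic.Allen2014_modularity_nearlyOrdinaryDihedral_Q`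
(`FontaineMazurGL2DyadicNearlyOrdinaryDihedral.lean`): it PROVES, in the case where the weight-one
form is unramified at `p`, the hypothesis `hW` ("Wiles 1988, Thm. 3 + classicality") of the tree's
architecture theorem
`Allen2014_modularity_nearlyOrdinaryDihedral_Q_of_finalthm_of_langlandsTunnell_of_wilesLift`, granted
the EXISTING named fact `Hida2000_thm326_exists_galoisRep` (Deligne's representation of a newform of
weight `≥ 2` over `ℚ̄_p` through a prescribed `p`-adic embedding; `EisensteinNewformLevelRaising`).

**Statement** (`exists_ordinary_newform_lift_of_weightOne_of_isUnramifiedAt`).  Let `p` be a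
prime, `f₁ ∈ S₁(Γ₁(N₁))` a newform of weight one, `ρ₁ : Γ_ℚ → GL₂(ℚ̄_p)` a continuous
representation with finite image (open kernel) attached to `f₁` away from `N₁` through an embedding
`ι₁ : K_{f₁} → ℚ̄_p`, UNRAMIFIED at the place `v` above `p`, and `τ : Γ_ℚ → GL₂(ℤ̄_p/𝔪)` an
irreducible reduction of `ρ₁`.  Then there are a newform `g ∈ S_k(Γ₁(N₀))`, `k ≥ 2`, an embedding
`ι_g : K_g → ℚ̄_p` with `|ι_g(a_p(g))|_p = 1` (**`g` is `p`-ordinary**) and a continuous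
`ρ_g : Γ_ℚ → GL₂(ℚ̄_p)` attached to `g` away from `N₀ p` through `ι_g`, whose residual
representation is `τ` (`ρ_g.IsResidualRepOf id τ`).

**Proof** (Deligne–Serre 1974, 6.9–6.11 and §8; Wiles 1988, §1; assembled from the tree).
1. `K_{f₁}` is a number field and the `a_n(f₁)` are algebraic integers ((2.7.2) in weight one,
   `DeligneSerre1974_span_integralLattice1_holds`); choose `ι : ℚ̄_p ≃ ℂ` extending `ι₁`
   (`exists_ringEquiv_padicAlgCl_complex_extends`).
2. `p ∤ N₁`: push `ρ₁` to `GL₂(ℂ)` along `ι` (finite image, `exists_map_of_isOpen_ker`); it is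
   attached to `f₁` through `K_{f₁} ⊆ ℂ`, so `N₁` is its Artin conductor (Deligne–Serre Thm. 4.6 (a),
   `artinConductorNat_eq_level_holds`), which is prime to `p` since `ρ₁` is unramified at `p`
   (`not_dvd_artinConductorNat_of_isUnramifiedAt`).
3. The roots `α, β ∈ ℚ̄_p` of `X² - ι⁻¹(a_p) X + ι⁻¹(ε(p))` are `p`-adic units (integral with unit
   product); `exists_ordinary_newform_congr_of_weight_one` (`WeightOneOrdinaryLiftProofs`) gives a
   newform `g₀ ∈ S_k(Γ₁(L₀))`, `k ≥ 2`, `L₀ ∣ N₁ p`, with `ι⁻¹ a_p(g₀) ≡ α`, `ι⁻¹ a_q(g₀) ≡ ι⁻¹ a_q(f₁)`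
   and `ι⁻¹(ε_{g₀}(q) q^{k-1}) ≡ ι⁻¹ ε(q)` modulo `𝔪` for the primes `q ∤ N₁ p`.
4. `Hida2000_thm326_exists_galoisRep` gives `ρ_g` over `ℚ̄_p` through `ι⁻¹|_{K_g}`; its Frobenius
   polynomials are congruent to those of `ρ₁` away from `N₁ L₀ p`, so `τ` is a residual
   representation of `ρ_g` (Chebotarev + Brauer–Nesbitt:
   `FramedGaloisRep.isResidualRepOf_of_isResidualRepOf_of_congruent`, `ResidualRepOfCongruentFrobenius`).

## References

* P. B. Allen, Compos. Math. 150 (2014), Lemma 87 (arXiv:1301.1113v2, §5.1.1, p. 70). [Allen2014]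
* A. Wiles, *On ordinary `λ`-adic representations associated to modular forms*, Invent. Math. 94
  (1988), 529–573, §1 and Thm. 3. [Wiles1988]
* P. Deligne, J.-P. Serre, *Formes modulaires de poids 1*, Ann. Sci. ÉNS (4) 7 (1974), 6.9–6.11,
  §8, Thm. 4.6 (a). [DeligneSerreASENS1974]
* H. Hida, *Modular Forms and Galois Cohomology* (2000), Thm. 3.26 (1). [Hida2000]
-/

noncomputable section

open scoped MatrixGroups ModularForm NumberField Polynomial

open CongruenceSubgroup Polynomial IsDedekindDomain IsLocalRing Field
  Rat.HeightOneSpectrum Literature.NumberTheory.GaloisRepresentations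
  Literature.NumberTheory.EllipticCurves Literature.NumberTheory.EllipticCurves.ModularForms
  Literature.NumberTheory.EllipticCurves.ModularForms.DeligneSerre1974

namespace Literature.NumberTheory.Automorphic

/-! ### A representation unramified at `p` has Artin conductor prime to `p` -/

section Conductor

variable {A : Type*} [CommRing A] [TopologicalSpace A] [IsTopologicalRing A] [Nontrivial A] {n : ℕ}

/-- **The numerical Artin conductor of a representation of `Γ_ℚ` unramified at `p` is prime to
`p`** (`a_v(ρ) = 0` at the place `v` above `p`, `artinConductorExponent_eq_zero_of_isUnramifiedAt_holds`,
and `N(ρ) = ∏_w ℓ_w^{a_w(ρ)}`, `GaloisRep.artinConductorNat_rat_eq_finprod`; if the product is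
infinite both sides are the junk value `1`). [cite: SerreLocalFields1979, Ch. VI §2, Thm 1' and §3] -/
theorem not_dvd_artinConductorNat_of_isUnramifiedAt (ρ : FramedGaloisRep ℚ A n) {p : ℕ}
    (hp : p.Prime) {v : HeightOneSpectrum (𝓞 ℚ)} (hv : ((p : ℕ) : 𝓞 ℚ) ∈ v.asIdeal)
    (h : ρ.IsUnramifiedAt v) : ¬ p ∣ ρ.toGaloisRep.artinConductorNat := by
  classical
  set a : HeightOneSpectrum (𝓞 ℚ) → ℕ := fun w ↦ ρ.toGaloisRep.artinConductorExponent w with ha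
  set P : HeightOneSpectrum (𝓞 ℚ) → ℕ := fun w ↦ ((primesEquiv w : Nat.Primes) : ℕ) with hP
  have hav : a v = 0 :=
    GaloisRep.artinConductorExponent_eq_zero_of_isUnramifiedAt_holds
      ((FramedGaloisRep.isUnramifiedAt_toGaloisRep_iff v ρ).2 h)
  have hPv : P v = p := by
    have hdvd : natGenerator v ∣ p := (Rat.natCast_mem_asIdeal_iff (v := v)).mp hv
    exact (Nat.prime_dvd_prime_iff_eq (primesEquiv v).2 hp).mp hdvd
  have hN : ρ.toGaloisRep.artinConductorNat = ∏ᶠ w, P w ^ a w :=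
    GaloisRep.artinConductorNat_rat_eq_finprod _
  rw [hN]
  intro hdvd
  by_cases hfin : (Function.mulSupport fun w ↦ P w ^ a w).Finite
  · rw [finprod_eq_prod _ hfin] at hdvd
    obtain ⟨w, hw, hpw⟩ := (Prime.dvd_finsetProd_iff hp.prime _).mp hdvd
    have hw' : P w ^ a w ≠ 1 := by
      have := hfin.mem_toFinset.mp hw
      rwa [Function.mem_mulSupport] at this
    have haw : a w ≠ 0 := fun h0 ↦ hw' (by rw [h0, pow_zero])
    have hpP : p ∣ P w := hp.dvd_of_dvd_pow hpw
    have hPw : P w = p := ((Nat.prime_dvd_prime_iff_eq hp (primesEquiv w).2).mp hpP).symm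
    have hwv : w = v :=
      (primesEquiv (R := 𝓞 ℚ)).injective (Subtype.ext (hPw.trans hPv.symm))
    rw [hwv] at haw
    exact haw hav
  · rw [finprod_of_infinite_mulSupport hfin] at hdvd
    exact hp.one_lt.ne' (Nat.dvd_one.mp hdvd)

end Conductor

/-! ### Roots of an integral quadratic in `ℚ̄_p` -/

section Roots

variable {p : ℕ} [Fact p.Prime]

/-- A root of `X² - s X + t` with `|s|, |t| ≤ 1` has `|x| ≤ 1` (ultrametric). [folklore] -/
theorem PadicAlgCl.norm_le_one_of_sq_eq {x s t : PadicAlgCl p} (hs : ‖s‖ ≤ 1) (ht : ‖t‖ ≤ 1)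
    (hx : x ^ 2 = s * x - t) : ‖x‖ ≤ 1 := by
  by_contra hle
  have hlt : 1 < ‖x‖ := not_le.mp hle
  have hx0 : 0 < ‖x‖ := lt_trans zero_lt_one hlt
  have h1 : ‖s * x - t‖ ≤ ‖x‖ := by
    have hneg := PadicAlgCl.isNonarchimedean p (s * x) (-t)
    rw [← sub_eq_add_neg, norm_neg] at hneg
    refine hneg.trans (max_le ?_ (ht.trans hlt.le))
    rw [norm_mul]
    exact mul_le_of_le_one_left (norm_nonneg _) hs
  rw [← hx, norm_pow, pow_two] at h1
  have h2 : ‖x‖ ≤ 1 := le_of_mul_le_mul_right (by rwa [one_mul]) hx0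
  exact not_lt.mpr h2 hlt

/-- Over the algebraically closed field `ℚ̄_p` every monic quadratic `X² - s X + t` has roots
`α + β = s`, `α β = t`. [folklore] -/
theorem PadicAlgCl.exists_add_eq_mul_eq (s t : PadicAlgCl p) :
    ∃ α β : PadicAlgCl p, α + β = s ∧ α * β = t := by
  obtain ⟨r, hr⟩ := IsAlgClosed.exists_pow_nat_eq (s ^ 2 - 4 * t) two_pos
  exact ⟨(s + r) / 2, (s - r) / 2, by ring, by linear_combination (-1 / 4 : PadicAlgCl p) * hr⟩

end Roots

/-! ### The theorem -/

section Main

variable {p : ℕ} [Fact p.Prime]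

set_option maxHeartbeats 1600000 in
/-- **A `p`-ordinary newform lift of weight `≥ 2` of the residual representation of a weight-one
newform unramified at `p`** (the case "`f₁` of level prime to `p`" of the input
`[WilesOrdinary, Theorem 3]` of Allen 2014, Lemma 87, proved classically: Deligne–Serre 6.9–6.11
with `U_p` in the Hecke family, Atkin–Lehner–Li, Chebotarev and Brauer–Nesbitt), granted Deligne's
`p`-adic representation of the lifted newform through the prescribed embedding
(`Hida2000_thm326_exists_galoisRep`).  See the module docstring.
[cite: Allen2014, Lemma 87 (arXiv:1301.1113v2, §5.1.1, p. 70)] [cite: Wiles1988, §1 and Thm. 3]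
[cite: DeligneSerreASENS1974, 6.9–6.11, §8 and Thm. 4.6 (a)] -/
theorem exists_ordinary_newform_lift_of_weightOne_of_isUnramifiedAt
    (hH : Hida2000_thm326_exists_galoisRep)
    {N₁ : ℕ} [NeZero N₁] (f₁ : CuspForm (Gamma1 N₁) 1)
    (ι₁ : coeffCharField f₁ →+* PadicAlgCl p) (ρ₁ : FramedGaloisRep ℚ (PadicAlgCl p) 2)
    (τ : absoluteGaloisGroup ℚ →* GL (Fin 2) (padicAlgClResidueField p))
    (hf₁ : IsNewform1 f₁) (hρ₁ : IsGaloisRepOfNewform1 f₁ ι₁ {q | q ∣ N₁} ρ₁)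
    (hopen : IsOpen ((ρ₁ : absoluteGaloisGroup ℚ →* GL (Fin 2) (PadicAlgCl p)).ker :
      Set (absoluteGaloisGroup ℚ)))
    (hce : ¬ HasCommonEigenvector τ) (hred : ρ₁.IsReductionOf (RingHom.id _) τ)
    {v : HeightOneSpectrum (𝓞 ℚ)} (hv : ((p : ℕ) : 𝓞 ℚ) ∈ v.asIdeal) (hunr : ρ₁.IsUnramifiedAt v) :
    ∃ (N₀ : ℕ) (_ : NeZero N₀) (k₀ : ℤ) (g : CuspForm (Gamma1 N₀) k₀)
      (ιg : coeffCharField g →+* PadicAlgCl p) (ρg : FramedGaloisRep ℚ (PadicAlgCl p) 2),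
      2 ≤ k₀ ∧ IsNewform1 g ∧
      ‖ιg ⟨(UpperHalfPlane.qExpansion 1 ⇑g).coeff p, cuspCoeff_mem_coeffCharField g p⟩‖ = 1 ∧
      IsGaloisRepOfNewform1 g ιg {q | q ∣ N₀ * p} ρg ∧
      ρg.IsResidualRepOf (RingHom.id _) τ := by
  classical
  have hp : p.Prime := Fact.out
  -- the valuation ring `ℤ̄_p`: membership and maximal ideal through the norm
  have hO : ∀ x : PadicAlgCl p, x ∈ padicAlgClIntegers p ↔ ‖x‖ ≤ 1 :=
    padicAlgCl_mem_valuationSubring_iff p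
  have hOm : ∀ x : padicAlgClIntegers p, x ∈ maximalIdeal (padicAlgClIntegers p) ↔
      ‖(x : PadicAlgCl p)‖ < 1 :=
    mem_maximalIdeal_iff_norm_lt_one hO
  -- ### Step 1: `K_{f₁}` is a number field, the `a_n(f₁)` are integral; `ι ⊇ ι₁`
  have hL := DeligneSerre1974_span_integralLattice1_holds N₁ 1
  haveI : FiniteDimensional ℚ (coeffField f₁) :=
    (IsNewform1.finiteDimensional_coeffField_of_span_integralLattice1 hL) hf₁
  haveI : FiniteDimensional ℚ (coeffCharField f₁) := finiteDimensional_coeffCharField f₁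
  haveI : NumberField (coeffCharField f₁) := NumberField.mk
  obtain ⟨ι, hι⟩ := exists_ringEquiv_padicAlgCl_complex_extends ι₁ (algebraMap (coeffCharField f₁) ℂ)
  have hιsymm : ∀ x : coeffCharField f₁, ι.symm (x : ℂ) = ι₁ x := fun x ↦ by
    apply ι.injective
    rw [RingEquiv.apply_symm_apply, hι x]
    rfl
  have hintZ : ∀ n, IsIntegral ℤ (ι.symm (cuspCoeff f₁ n)) := fun n ↦
    (IsNewform1.isIntegral_cuspCoeff hL le_rfl hf₁ n).map (ι.symm : ℂ →+* PadicAlgCl p).toIntAlgHom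
  have hint : ∀ n, ‖ι.symm (cuspCoeff f₁ n)‖ ≤ 1 := fun n ↦
    (hO _).mp (mem_padicAlgClIntegers_of_isIntegral (hintZ n))
  -- ### Step 2: `p ∤ N₁` (Deligne–Serre Thm. 4.6 (a) for the complex transport of `ρ₁`)
  obtain ⟨ρℂ, hρℂ, -, -⟩ := ρ₁.exists_map_of_isOpen_ker hopen (ι : PadicAlgCl p →+* ℂ)
  have hcomp : (ι : PadicAlgCl p →+* ℂ).comp ι₁ = algebraMap (coeffCharField f₁) ℂ :=
    RingHom.ext fun x ↦ hι x
  have hρℂf : IsGaloisRepOfNewform1 f₁ (algebraMap (coeffCharField f₁) ℂ) {q | q ∣ N₁} ρℂ := by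
    rw [← hcomp]
    exact hρ₁.of_map _ hρℂ
  have hcond : ρℂ.toGaloisRep.artinConductorNat = N₁ :=
    artinConductorNat_eq_level_holds (f := f₁) (ρ := ρℂ) hf₁ hρℂf
  have hpN : ¬ p ∣ N₁ := by
    rw [← hcond]
    exact not_dvd_artinConductorNat_of_isUnramifiedAt ρℂ hp hv
      (FramedGaloisRep.isUnramifiedAt_of_map hρℂ hunr)
  -- ### Step 3: the data of `exists_ordinary_newform_congr_of_weight_one`
  set χ : DirichletCharacter ℂ N₁ := nebentypus f₁ with hχ
  have hfχ : f₁ ∈ nebentypusSubspace N₁ 1 χ := IsNewform1.mem_nebentypusSubspace_nebentypus_holds hf₁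
  have hf1 : cuspCoeff f₁ 1 = 1 := hf₁.2.2.2
  have hT : ∀ (q : ℕ) (hq : q.Prime), ¬ q ∣ N₁ →
      (haveI : NeZero q := ⟨hq.ne_zero⟩;
        Literature.NumberTheory.EllipticCurves.ModularForms.heckeT (Gamma1 N₁) 1 q f₁) =
        cuspCoeff f₁ q • f₁ := by
    intro q hq _
    haveI : NeZero q := ⟨hq.ne_zero⟩
    exact hf₁.heckeT_apply_eq_cuspCoeff_smul q hq
  -- the roots `α, β ∈ ℚ̄_p` of `X² - ι⁻¹(a_p) X + ι⁻¹(ε(p))`: `p`-adic units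
  obtain ⟨α, β, hsum, hprod⟩ :=
    PadicAlgCl.exists_add_eq_mul_eq (ι.symm (cuspCoeff f₁ p)) (ι.symm (χ p))
  have hnχ := WeightOneOrdinaryLift.norm_dirichletCharacter_le_one ι χ
  have hnprod : ‖α * β‖ = 1 := by
    rw [hprod]; exact (hnχ _).2 (ZMod.isUnit_prime_of_not_dvd hp hpN)
  have hαle : ‖α‖ ≤ 1 := PadicAlgCl.norm_le_one_of_sq_eq (hint p) (hnχ _).1
    (by rw [← hsum, ← hprod]; ring)
  have hβle : ‖β‖ ≤ 1 := PadicAlgCl.norm_le_one_of_sq_eq (hint p) (hnχ _).1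
    (by rw [← hsum, ← hprod]; ring)
  have hαunit : ‖α‖ = 1 := by
    by_contra hne
    have hlt : ‖α‖ < 1 := lt_of_le_of_ne hαle hne
    have : ‖α * β‖ < 1 := by
      rw [norm_mul]; exact mul_lt_one_of_nonneg_of_lt_one_left (norm_nonneg _) hlt hβle
    rw [hnprod] at this
    exact lt_irrefl _ this
  have hαβ : ι α + ι β = cuspCoeff f₁ p := by rw [← map_add, hsum, RingEquiv.apply_symm_apply]
  have hαβ' : ι α * ι β = χ p := by rw [← map_mul, hprod, RingEquiv.apply_symm_apply]
  have hα : ‖ι.symm (ι α)‖ = 1 := by rw [RingEquiv.symm_apply_apply]; exact hαunit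
  have hβ : ‖ι.symm (ι β)‖ ≤ 1 := by rw [RingEquiv.symm_apply_apply]; exact hβle
  obtain ⟨k, L₀, hL₀0, hL₀, g₀, hk2, -, hg₀, hap, haq, hε⟩ :=
    exists_ordinary_newform_congr_of_weight_one ι hpN hfχ hf1 hint hT hαβ hαβ' hα hβ
  -- ### Step 4: Deligne's representation of `g₀` through `ι⁻¹`, and the residual comparison
  obtain ⟨ρg, hρg, -⟩ := hH g₀ hk2 hg₀ p ι
  set ιg : coeffCharField g₀ →+* PadicAlgCl p :=
    (ι.symm : ℂ →+* PadicAlgCl p).comp (algebraMap (coeffCharField g₀) ℂ) with hιg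
  -- norms needed below
  have hnorm_ag : ∀ q : ℕ, q.Prime → ¬ q ∣ N₁ * p → ‖ι.symm (cuspCoeff g₀ q)‖ ≤ 1 := by
    intro q hq hqL
    have : ι.symm (cuspCoeff g₀ q) = (ι.symm (cuspCoeff g₀ q) - ι.symm (cuspCoeff f₁ q)) +
        ι.symm (cuspCoeff f₁ q) := by ring
    rw [this]
    exact (PadicAlgCl.isNonarchimedean p _ _).trans (max_le (haq q hq hqL).le (hint q))
  have hnorm_εg : ∀ q : ℕ, q.Prime → ¬ q ∣ N₁ * p →
      ‖ι.symm (nebentypus g₀ (q : ZMod L₀) * (q : ℂ) ^ (k - 1))‖ ≤ 1 := by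
    intro q hq hqL
    have : ι.symm (nebentypus g₀ (q : ZMod L₀) * (q : ℂ) ^ (k - 1)) =
        (ι.symm (nebentypus g₀ (q : ZMod L₀) * (q : ℂ) ^ (k - 1)) - ι.symm (χ q)) + ι.symm (χ q) := by
      ring
    rw [this]
    exact (PadicAlgCl.isNonarchimedean p _ _).trans (max_le (hε q hq hqL).le (hnχ _).1)
  have hnorm_εf : ∀ q : ℕ, ‖ι.symm ((χ (q : ZMod N₁) : ℂ) * (q : ℂ) ^ ((1 : ℤ) - 1))‖ ≤ 1 := by
    intro q
    rw [sub_self, zpow_zero, mul_one]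
    exact (hnχ _).1
  -- the exceptional set `S = {v : ℓ_v ∣ N₁ L₀ p}`
  set S : Set (HeightOneSpectrum (𝓞 ℚ)) :=
    {w | ((primesEquiv w : Nat.Primes) : ℕ) ∣ N₁ * L₀ * p} with hSdef
  have hM0 : N₁ * L₀ * p ≠ 0 := mul_ne_zero (mul_ne_zero (NeZero.ne N₁) (NeZero.ne L₀)) hp.ne_zero
  have hS : S.Finite := by
    have hdiv : {q : ℕ | q ∣ N₁ * L₀ * p}.Finite :=
      (Nat.divisors (N₁ * L₀ * p)).finite_toSet.subset fun q hq ↦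
        (Finset.mem_coe.mpr (Nat.mem_divisors.mpr ⟨hq, hM0⟩))
    refine (hdiv.preimage (f := fun w : HeightOneSpectrum (𝓞 ℚ) ↦ ((primesEquiv w : Nat.Primes) : ℕ))
      (Function.Injective.injOn fun w w' h ↦ ?_)).subset fun w hw ↦ hw
    exact (primesEquiv (R := 𝓞 ℚ)).injective (Subtype.ext h)
  -- congruent Frobenius characteristic polynomials outside `S`
  have hcong : ∀ w ∉ S, ρ₁.IsUnramifiedAt w ∧ ρg.IsUnramifiedAt w ∧
      ∃ P P' : Polynomial (padicAlgClIntegers p),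
        ρ₁.HasFrobCharpolyAt w (P.map (padicAlgClIntegers p).subtype) ∧
        ρg.HasFrobCharpolyAt w (P'.map (padicAlgClIntegers p).subtype) ∧
        P.map (residue (padicAlgClIntegers p)) = P'.map (residue (padicAlgClIntegers p)) := by
    intro w hw
    set q : ℕ := ((primesEquiv w : Nat.Primes) : ℕ) with hqdef
    have hq : q.Prime := (primesEquiv w).2
    have hwS : ¬ q ∣ N₁ * L₀ * p := hw
    have hqN₁ : ¬ q ∣ N₁ := fun h ↦ hwS ((h.mul_right L₀).mul_right p)
    have hqL₀p : ¬ q ∣ L₀ * p := fun h ↦ hwS (by rw [mul_assoc]; exact dvd_mul_of_dvd_right h N₁)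
    have hqN₁p : ¬ q ∣ N₁ * p := fun h ↦ hwS (by
      rw [mul_right_comm]; exact h.mul_right L₀)
    obtain ⟨hur₁, hchar₁⟩ := hρ₁ w hqN₁
    obtain ⟨hurg, hcharg⟩ := hρg w hqL₀p
    -- the integral Hecke polynomials
    let c₁ : padicAlgClIntegers p := ⟨ι.symm (cuspCoeff f₁ q), (hO _).mpr (hint q)⟩
    let c₀ : padicAlgClIntegers p :=
      ⟨ι.symm ((χ (q : ZMod N₁) : ℂ) * (q : ℂ) ^ ((1 : ℤ) - 1)), (hO _).mpr (hnorm_εf q)⟩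
    let d₁ : padicAlgClIntegers p := ⟨ι.symm (cuspCoeff g₀ q), (hO _).mpr (hnorm_ag q hq hqN₁p)⟩
    let d₀ : padicAlgClIntegers p :=
      ⟨ι.symm (nebentypus g₀ (q : ZMod L₀) * (q : ℂ) ^ (k - 1)), (hO _).mpr (hnorm_εg q hq hqN₁p)⟩
    refine ⟨hur₁, hurg, X ^ 2 - C c₁ * X + C c₀, X ^ 2 - C d₁ * X + C d₀, ?_, ?_, ?_⟩
    · -- `ρ₁`: `(heckePolynomial f₁ q).map ι₁`
      have e : (X ^ 2 - C c₁ * X + C c₀ : Polynomial (padicAlgClIntegers p)).map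
          (padicAlgClIntegers p).subtype =
          (Literature.NumberTheory.EllipticCurves.ModularForms.heckePolynomial f₁ q).map ι₁ := by
        simp only [Literature.NumberTheory.EllipticCurves.ModularForms.heckePolynomial,
          Polynomial.map_add, Polynomial.map_sub, Polynomial.map_mul, Polynomial.map_pow, map_X,
          map_C, ← hιsymm]
        rfl
      rw [e]
      exact hchar₁
    · -- `ρg`: `(heckePolynomial g₀ q).map ιg`
      have e : (X ^ 2 - C d₁ * X + C d₀ : Polynomial (padicAlgClIntegers p)).map
          (padicAlgClIntegers p).subtype =
          (Literature.NumberTheory.EllipticCurves.ModularForms.heckePolynomial g₀ q).map ιg := by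
        simp only [Literature.NumberTheory.EllipticCurves.ModularForms.heckePolynomial,
          Polynomial.map_add, Polynomial.map_sub, Polynomial.map_mul, Polynomial.map_pow, map_X,
          map_C, hιg, RingHom.comp_apply]
        rfl
      rw [e]
      exact hcharg
    · -- the reductions agree
      have h₁ : residue (padicAlgClIntegers p) c₁ = residue (padicAlgClIntegers p) d₁ := by
        rw [← sub_eq_zero, ← map_sub, IsLocalRing.residue_eq_zero_iff, hOm]
        change ‖ι.symm (cuspCoeff f₁ q) - ι.symm (cuspCoeff g₀ q)‖ < 1
        rw [← norm_neg, neg_sub]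
        exact haq q hq hqN₁p
      have h₀ : residue (padicAlgClIntegers p) c₀ = residue (padicAlgClIntegers p) d₀ := by
        rw [← sub_eq_zero, ← map_sub, IsLocalRing.residue_eq_zero_iff, hOm]
        change ‖ι.symm ((χ (q : ZMod N₁) : ℂ) * (q : ℂ) ^ ((1 : ℤ) - 1)) -
          ι.symm (nebentypus g₀ (q : ZMod L₀) * (q : ℂ) ^ (k - 1))‖ < 1
        rw [sub_self, zpow_zero, mul_one, ← norm_neg, neg_sub]
        exact hε q hq hqN₁p
      simp only [Polynomial.map_add, Polynomial.map_sub, Polynomial.map_mul, Polynomial.map_pow,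
        map_X, map_C, h₁, h₀]
  -- residual representations: `τ` of `ρ₁` (irreducible reduction), some `τ'` of `ρg`
  have hirrτ : (glRepresentation τ).IsIrreducible :=
    (isIrreducible_iff_not_hasCommonEigenvector τ).2 hce
  have hτ : ρ₁.IsResidualRepOf (RingHom.id _) τ := hred.isResidualRepOf_of_isIrreducible hirrτ
  obtain ⟨τ', hτ'⟩ := ρg.exists_isResidualRepOf_fin_two
  have hres : ρg.IsResidualRepOf (RingHom.id _) τ :=
    ρ₁.isResidualRepOf_of_isResidualRepOf_of_congruent ρg hS hcong hτ hτ'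
  -- ### Conclusion
  refine ⟨L₀, hL₀0, k, g₀, ιg, ρg, hk2, hg₀, ?_, hρg, hres⟩
  change ‖ι.symm (algebraMap (coeffCharField g₀) ℂ ⟨(UpperHalfPlane.qExpansion 1 ⇑g₀).coeff p,
    cuspCoeff_mem_coeffCharField g₀ p⟩)‖ = 1
  exact WeightOneOrdinaryLift.norm_eq_one_of_norm_sub_lt_one hα hap

end Main

end Literature.NumberTheory.Automorphic

end
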